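import Literature.MathematicalPhysics.QuantumFieldTheory.Balaban1983to89.B9Thm31SiteCurvatureCommutatorsY

/-!
# `Balaban1983to89.B9Thm31SiteBochnerY` — T. Bałaban, *Propagators for lattice gauge theories in a background field*, Commun. Math. Phys. **99** (1985) 389–434
# [Balaban1985BackgroundPropagators] (3.8) p. 392, (3.23) p. 395, (3.35) p. 396, (3.46) p. 398 (the second-order members `G′∇*∇*`, `∇∇G′`), (3.117)–(3.120) p. 419:
# ★★★ **THE DISCRETE BOCHNER–WEITZENBÖCK IDENTITY AND INEQUALITY IN `L²` FOR def-Y's COVARIANT DIFFERENCES — `Σ_{μν}‖∇_μ∇_νw‖²` IS `‖Δ_Uw‖²` PLUS TWO CURVATURE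
# PAIRINGS, HENCE `≤ (4∕3)(‖Δ_Uw‖² + curvature-weighted ‖w‖², ‖∇w‖²)` UNDER A POINTWISE PLAQUETTE WINDOW; AND THE DUALITY `∇∇T ⇒ T∇*∇*`** — the `H²` engine for the
# second-order members of (3.46) for the local inverses `G′_□` (dag-n06-k's `L2SecondLegs37.l5 = (M_hG′_□M_h)∘∇*_ν∇*_μ`, `FactorsL2Second37.facDD`), the ONE open piece of
# width seat `pub-ymgap-dag-n06-w1`'s lane (file 27 of its set)

statement-level skeleton of published theorems with citation tags; proofs where landed; nothing here is a claim about the Yang–Mills mass gap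

THE PRINT ∕ WHY.  (3.46) p. 398 lists, for `G′(U)` on the class (3.35), `|G′D*D*λ|, |∇∇G′λ| ≤ B₀e^{−δ₀d}|λ|` (no `(Lʲη)` power); p. 419 commutes `Δ` past `D` by
(3.117)–(3.120) with plaquette remainders.  In `L²` the covariant Hessian of ANY torus site function `w` is controlled by its covariant Laplacian through the lattice
Bochner–Weitzenböck computation done here ONCE, at def-Y's letters: twice (3.8) («D* is the adjoint of D», dag-n06-i's `trIP_cdS_left`) and the two-term commutators of file 26;
the outer `∇*_μ` never crosses a commutator, so the current `J = D*F` of (3.36) does NOT enter (contrast the NE9 team's sup-norm `B9Eq3117CommutatorBound`, which needs `‖J‖ ≤ α`).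
The successor's use (HANDOFF of the seat, piece (A2)): `w := M_hG′_□(U)M_hΨ` is a torus function supported inside □̃, `Δ_Uw = M_h²Ψ + K(h)G′_□M_hΨ − (averaging term)` by
(3.88)'s commutator `K(h) = [Δ′, M_h]` (file 23's `hs_KhY_apply_le`) and `P_□̃Δ′G′_□ = P_□̃` (file 20), the window `ε(z) = O(α₀)L^{−2j}` near □̃ from (3.35)
(`B9Eq335PlaquetteAtLettersY.norm_holY_sub_one_le_of_reg335` through file 26's `norm_plaqU_sub_one_le_of_holY`), and `duality` turns the `H²` bound into `l5`.

WHAT IS PROVED (sorry-free; 0 `def`; `𝔸 = M_N(ℂ)`, trace pairing `trIP 1`, `‖·‖² = trIP 1 · ·`).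
* `lapS_eq_sum`; ★★★ `bochner_identity` (unitary-valued `U`, every `w`):
  `Σ_{μν} ‖∇_μ∇_νw‖² = ‖Δ_Uw‖² + Σ_{μν} (⟨∇_μ∇_νw, [∇_μ,∇_ν]w⟩ + ⟨[∇*_ν,∇_μ]∇_νw, ∇_μw⟩)` (`Δ_U = Node00.OpsYOfLetters.lapS = Σ_μ∇*_μ∇_μ`).
* `abs_re_trace_le_of_hs_le` (pointwise Cauchy–Schwarz + AM–GM); ★★★ `bochner_le` (`G ≤ U(N)`, pointwise window `|plaqU μ ν z − 1| ≤ ε(z)`):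
  `Σ_{μν}‖∇_μ∇_νw‖² ≤ (4∕3)·(‖Δ_Uw‖² + Σ_{μν}[4Σ_z ε(z)²HS(w(z+e_μ+e_ν)) + Σ_z ε(z−e_ν)(HS((∇_νw)(z−e_ν+e_μ)) + HS((∇_μw)(z)))])`;
  ★★ `bochner_le_uniform` (constant window `ε₀`): `≤ (4∕3)·(‖Δ_Uw‖² + 4(d+1)²ε₀²‖w‖² + 2(d+1)ε₀Σ_μ‖∇_μw‖²)`.
* ★★ `trIP_T_cdsS_cdsS_le_of_hessian` (duality): for a trace-symmetric `T` (e.g. `M_hG′_□M_h`), `∀Ψ ‖∇_μ∇_ν(TΨ)‖² ≤ C²‖Ψ‖²` ⇒ `∀λ ‖T(∇*_ν∇*_μλ)‖² ≤ C²‖λ‖²`.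
* §4 bookkeeping for file 28: `sum_levelMass_avg_le` (`Σ_z m_zΣ_w a(z,w)HS(Λ w) ≤ m_D²‖Λ‖²` for `Λ` living on `D` with levels `≥ j′_D`), `sum_sum_const_add_pair`.
HONEST SCOPE: [folklore] lattice identity + bookkeeping; the `H²` estimate for `G′_□` itself (piece (A2)) is NOT here; NOT a node discharge, NOT summit progress; count-neutral;
nothing continuum ∕ OS ∕ mass gap ∕ Clay; the YM mass gap (Clay) is NOT proved by any of this — R4 closes the conditional finite-𝕋⁴ rung `BalabanLadder.UV` only.  NEW file
importing file 26 only.  Net new unproved facts: 0.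
-/

noncomputable section

namespace Literature.MathematicalPhysics.QuantumFieldTheory.Balaban1983to89.B9Thm31SiteBochnerY

open Literature.MathematicalPhysics.QuantumFieldTheory.Balaban1983to89
open Node00 B6KLevelCensusIndexV1 B6MultiLevelTorusOperator B6GlobalChartV1 B9BackgroundsKLevelV1
  B9Eq39Adjoint B9Thm311ReadingCoords B9Thm311DeltaPrimePos B9Ineq369CurvatureSmallAtLettersY B9Thm31SiteCoerciveGaugeBlockY B9Thm31SiteGpBoundsReg335Y
open Literature.MathematicalPhysics.QuantumFieldTheory.Balaban1983to89.B9Ineq349SiteAdjoint (trIP_comm trIP_cdS_left)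
open Literature.MathematicalPhysics.QuantumFieldTheory.Balaban1983to89.B9Eq3132CoerciveVariational (trIP_sub_right trIP_sub_left)
open Literature.MathematicalPhysics.QuantumFieldTheory.Balaban1983to89.B9Thm31SiteCurvatureCommutatorsY
open scoped Matrix Matrix.Norms.L2Operator

variable {d ℓ : ℕ} {hd : 1 ≤ d + 1} {hL : Odd (ℓ + 1) ∧ 1 < ℓ + 1} {b₀ b₁ : ℝ}
variable (i : KIdx d ℓ hd hL b₀ b₁) {N : ℕ} {G : Subgroup (Matrix (Fin N) (Fin N) ℂ)ˣ}

section Bochner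

/-! ## §1 The identity and the inequality under a pointwise plaquette window -/

/-- `Δ_U w = Σ_μ ∇*_μ∇_μ w` as a sum of site functions. [cite: Balaban1985BackgroundPropagators, (3.23) p.395, bookkeeping] -/
theorem lapS_eq_sum (U : CfgY (Matrix (Fin N) (Fin N) ℂ) i) (w : SiteY i → Matrix (Fin N) (Fin N) ℂ) :
    lapS i U w = ∑ μ : Fin (d + 1), cdsS i U μ (cdS i U μ w) := by
  funext z; simp only [lapS, Finset.sum_apply]

/-- ★★★ **THE DISCRETE BOCHNER–WEITZENBÖCK IDENTITY IN `L²`** (unitary-valued `U`, any site function `w` on the torus):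
`Σ_{μν} ‖∇_μ∇_νw‖² = ‖Δ_Uw‖² + Σ_{μν} (⟨∇_μ∇_νw, [∇_μ,∇_ν]w⟩ + ⟨[∇*_ν,∇_μ]∇_νw, ∇_μw⟩)` — twice (3.8) («D* is the adjoint of D»); the two commutators
are the plaquette defects of `cdS_cdS_sub_apply` ∕ `cdsS_cdS_sub_apply` (the current `J = D*F` never appears: the outer `∇*_μ` stays on the other side).
[cite: Balaban1985BackgroundPropagators, (3.8) p.392, (3.23) p.395, (3.117)–(3.120) p.419] -/
theorem bochner_identity {U : CfgY (Matrix (Fin N) (Fin N) ℂ) i} (hU : ∀ μ x, (U μ x : Matrix (Fin N) (Fin N) ℂ) ∈ unitary (Matrix (Fin N) (Fin N) ℂ))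
    (w : SiteY i → Matrix (Fin N) (Fin N) ℂ) :
    ∑ μ : Fin (d + 1), ∑ ν : Fin (d + 1), trIP (fun _ => (1 : ℝ)) (cdS i U μ (cdS i U ν w)) (cdS i U μ (cdS i U ν w))
      = trIP (fun _ => (1 : ℝ)) (lapS i U w) (lapS i U w)
        + ∑ μ : Fin (d + 1), ∑ ν : Fin (d + 1),
            (trIP (fun _ => (1 : ℝ)) (cdS i U μ (cdS i U ν w)) (cdS i U μ (cdS i U ν w) - cdS i U ν (cdS i U μ w))
              + trIP (fun _ => (1 : ℝ)) (cdsS i U ν (cdS i U μ (cdS i U ν w)) - cdS i U μ (cdsS i U ν (cdS i U ν w))) (cdS i U μ w)) := by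
  have hT : trIP (fun _ => (1 : ℝ)) (lapS i U w) (lapS i U w)
      = ∑ μ : Fin (d + 1), ∑ ν : Fin (d + 1), trIP (fun _ => (1 : ℝ)) (cdsS i U ν (cdS i U ν w)) (cdsS i U μ (cdS i U μ w)) := by
    rw [lapS_eq_sum, B9Thm311LocalInversePosY.trIP_sum_right]
    refine Finset.sum_congr rfl fun μ _ => ?_
    rw [trIP_comm, B9Thm311LocalInversePosY.trIP_sum_right]
    exact Finset.sum_congr rfl fun ν _ => trIP_comm _ _ _
  rw [hT, ← Finset.sum_add_distrib]
  refine Finset.sum_congr rfl fun μ _ => ?_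
  rw [← Finset.sum_add_distrib]
  refine Finset.sum_congr rfl fun ν _ => ?_
  -- one term: `A = ∇_μ∇_νw`, `B = ∇_ν∇_μw`, `g = ∇_νw`
  have e1 : trIP (fun _ => (1 : ℝ)) (cdS i U μ (cdS i U ν w)) (cdS i U ν (cdS i U μ w))
      = trIP (fun _ => (1 : ℝ)) (cdS i U μ w) (cdsS i U ν (cdS i U μ (cdS i U ν w))) := by
    rw [trIP_comm]; exact trIP_cdS_left i hU ν _ _
  have e2 : trIP (fun _ => (1 : ℝ)) (cdS i U μ w) (cdsS i U ν (cdS i U μ (cdS i U ν w)))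
      = trIP (fun _ => (1 : ℝ)) (cdS i U μ w) (cdS i U μ (cdsS i U ν (cdS i U ν w)))
        + trIP (fun _ => (1 : ℝ)) (cdS i U μ w) (cdsS i U ν (cdS i U μ (cdS i U ν w)) - cdS i U μ (cdsS i U ν (cdS i U ν w))) := by
    rw [← trIP_add_right, add_sub_cancel]
  have e3 : trIP (fun _ => (1 : ℝ)) (cdS i U μ w) (cdS i U μ (cdsS i U ν (cdS i U ν w)))
      = trIP (fun _ => (1 : ℝ)) (cdsS i U ν (cdS i U ν w)) (cdsS i U μ (cdS i U μ w)) := by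
    rw [trIP_comm]; exact trIP_cdS_left i hU μ _ _
  have e4 : trIP (fun _ => (1 : ℝ)) (cdS i U μ (cdS i U ν w)) (cdS i U μ (cdS i U ν w))
      = trIP (fun _ => (1 : ℝ)) (cdS i U μ (cdS i U ν w)) (cdS i U ν (cdS i U μ w))
        + trIP (fun _ => (1 : ℝ)) (cdS i U μ (cdS i U ν w)) (cdS i U μ (cdS i U ν w) - cdS i U ν (cdS i U μ w)) := by
    rw [trIP_sub_right]; ring
  rw [e4, e1, e2, e3, trIP_comm (fun _ => (1 : ℝ)) (cdS i U μ w)]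
  ring

/-- pointwise: `|Re tr(PᴴQ)| ≤ ε(HS(g) + HS(Q))` once `HS(P) ≤ 4ε²HS(g)`, `ε ≥ 0`. [cite: Balaban1985Averaging, (17)–(20) pp.20–21, bookkeeping] -/
theorem abs_re_trace_le_of_hs_le {P Q g : Matrix (Fin N) (Fin N) ℂ} {ε : ℝ} (hε : 0 ≤ ε)
    (hP : ∑ a, ∑ b, ‖P a b‖ ^ 2 ≤ 4 * ε ^ 2 * ∑ a, ∑ b, ‖g a b‖ ^ 2) :
    |(Matrix.trace (Pᴴ * Q)).re| ≤ ε * (∑ a, ∑ b, ‖g a b‖ ^ 2 + ∑ a, ∑ b, ‖Q a b‖ ^ 2) := by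
  have h := abs_re_trace_le P Q
  have hg := hs_nonneg g
  have hQ := hs_nonneg Q
  have h1 : Real.sqrt (∑ a, ∑ b, ‖P a b‖ ^ 2) ≤ 2 * ε * Real.sqrt (∑ a, ∑ b, ‖g a b‖ ^ 2) := by
    rw [← Real.sqrt_sq (by positivity : (0 : ℝ) ≤ 2 * ε), ← Real.sqrt_mul (by positivity)]
    exact Real.sqrt_le_sqrt (by nlinarith)
  have h2 : 2 * Real.sqrt (∑ a, ∑ b, ‖g a b‖ ^ 2) * Real.sqrt (∑ a, ∑ b, ‖Q a b‖ ^ 2)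
      ≤ ∑ a, ∑ b, ‖g a b‖ ^ 2 + ∑ a, ∑ b, ‖Q a b‖ ^ 2 := by
    nlinarith [sq_nonneg (Real.sqrt (∑ a, ∑ b, ‖g a b‖ ^ 2) - Real.sqrt (∑ a, ∑ b, ‖Q a b‖ ^ 2)),
      Real.sq_sqrt hg, Real.sq_sqrt hQ]
  calc |(Matrix.trace (Pᴴ * Q)).re| ≤ Real.sqrt (∑ a, ∑ b, ‖P a b‖ ^ 2) * Real.sqrt (∑ a, ∑ b, ‖Q a b‖ ^ 2) := h
    _ ≤ 2 * ε * Real.sqrt (∑ a, ∑ b, ‖g a b‖ ^ 2) * Real.sqrt (∑ a, ∑ b, ‖Q a b‖ ^ 2) :=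
        mul_le_mul_of_nonneg_right h1 (Real.sqrt_nonneg _)
    _ = ε * (2 * Real.sqrt (∑ a, ∑ b, ‖g a b‖ ^ 2) * Real.sqrt (∑ a, ∑ b, ‖Q a b‖ ^ 2)) := by ring
    _ ≤ ε * (∑ a, ∑ b, ‖g a b‖ ^ 2 + ∑ a, ∑ b, ‖Q a b‖ ^ 2) := mul_le_mul_of_nonneg_left h2 hε

/-- ★★★ **THE DISCRETE BOCHNER–WEITZENBÖCK INEQUALITY IN `L²` UNDER A POINTWISE PLAQUETTE WINDOW**: for a `G`-valued `U` (`G ≤ U(N)`) with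
`|U(∂p_{μν}(z)) − 1| ≤ ε(z)` (all `μ, ν, z`) and ANY site function `w`,
`Σ_{μν}‖∇_μ∇_νw‖² ≤ (4∕3)·(‖Δ_Uw‖² + Σ_{μν}[4Σ_z ε(z)²HS(w(z+e_μ+e_ν)) + Σ_z ε(z−e_ν)(HS((∇_νw)(z−e_ν+e_μ)) + HS((∇_μw)(z)))])`
— covariant Hessians are controlled by the covariant Laplacian plus curvature-weighted `L²` norms of `w` and `∇w`; no current `J` enters.
[cite: Balaban1985BackgroundPropagators, (3.8) p.392, (3.23) p.395, (3.35) p.396, (3.46) p.398 (the second-order members), (3.117)–(3.120) p.419] -/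
theorem bochner_le (hG : G ≤ B7Prop2Explicit.unitaryUnits (Matrix (Fin N) (Fin N) ℂ)) {U : CfgY (Matrix (Fin N) (Fin N) ℂ) i}
    (hU : ∀ μ x, U μ x ∈ G) {ε : SiteY i → ℝ}
    (hF : ∀ μ ν z, ‖((plaqU (shiftY i) (UboxY i U) μ ν z : (Matrix (Fin N) (Fin N) ℂ)ˣ) : Matrix (Fin N) (Fin N) ℂ) - 1‖ ≤ ε z)
    (w : SiteY i → Matrix (Fin N) (Fin N) ℂ) :
    ∑ μ : Fin (d + 1), ∑ ν : Fin (d + 1), trIP (fun _ => (1 : ℝ)) (cdS i U μ (cdS i U ν w)) (cdS i U μ (cdS i U ν w))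
      ≤ 4 / 3 * (trIP (fun _ => (1 : ℝ)) (lapS i U w) (lapS i U w)
          + ∑ μ : Fin (d + 1), ∑ ν : Fin (d + 1),
              (4 * ∑ z, ε z ^ 2 * ∑ a, ∑ b, ‖w (shiftY i ν (shiftY i μ z)) a b‖ ^ 2
                + ∑ z, ε ((shiftY i ν).symm z) * (∑ a, ∑ b, ‖cdS i U ν w (shiftY i μ ((shiftY i ν).symm z)) a b‖ ^ 2
                    + ∑ a, ∑ b, ‖cdS i U μ w z a b‖ ^ 2))) := by
  have hUu : ∀ μ x, (U μ x : Matrix (Fin N) (Fin N) ℂ) ∈ unitary (Matrix (Fin N) (Fin N) ℂ) := fun μ x => hG (hU μ x)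
  have hε : ∀ z, 0 ≤ ε z := fun z => le_trans (norm_nonneg _) (hF 0 0 z)
  have hid := bochner_identity i hUu w
  -- bound the two commutator pairings termwise
  have hC : ∀ μ ν : Fin (d + 1),
      trIP (fun _ => (1 : ℝ)) (cdS i U μ (cdS i U ν w)) (cdS i U μ (cdS i U ν w) - cdS i U ν (cdS i U μ w))
        ≤ trIP (fun _ => (1 : ℝ)) (cdS i U μ (cdS i U ν w)) (cdS i U μ (cdS i U ν w)) / 4
          + 4 * ∑ z, ε z ^ 2 * ∑ a, ∑ b, ‖w (shiftY i ν (shiftY i μ z)) a b‖ ^ 2 := by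
    intro μ ν
    set A := cdS i U μ (cdS i U ν w)
    set Cw := cdS i U μ (cdS i U ν w) - cdS i U ν (cdS i U μ w)
    have hA0 : 0 ≤ trIP (fun _ => (1 : ℝ)) A A := trIP_self_nonneg _ (fun _ => one_pos) A
    have hC0 : 0 ≤ trIP (fun _ => (1 : ℝ)) Cw Cw := trIP_self_nonneg _ (fun _ => one_pos) Cw
    have hcs := abs_trIP_le (fun _ => (1 : ℝ)) (fun _ => one_pos) A Cw
    have hCC : trIP (fun _ => (1 : ℝ)) Cw Cw ≤ 4 * ∑ z, ε z ^ 2 * ∑ a, ∑ b, ‖w (shiftY i ν (shiftY i μ z)) a b‖ ^ 2 := by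
      rw [trIP_one_self_eq, Finset.mul_sum]
      refine Finset.sum_le_sum fun z _ => ?_
      have h := hs_cdS_cdS_sub_le i hG hU hF μ ν w z
      rw [← mul_assoc]
      exact h
    have hamgm : Real.sqrt (trIP (fun _ => (1 : ℝ)) A A) * Real.sqrt (trIP (fun _ => (1 : ℝ)) Cw Cw)
        ≤ trIP (fun _ => (1 : ℝ)) A A / 4 + trIP (fun _ => (1 : ℝ)) Cw Cw := by
      nlinarith [sq_nonneg (Real.sqrt (trIP (fun _ => (1 : ℝ)) A A) / 2 - Real.sqrt (trIP (fun _ => (1 : ℝ)) Cw Cw)),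
        Real.sq_sqrt hA0, Real.sq_sqrt hC0]
    linarith [(le_abs_self _).trans hcs]
  have hC' : ∀ μ ν : Fin (d + 1),
      trIP (fun _ => (1 : ℝ)) (cdsS i U ν (cdS i U μ (cdS i U ν w)) - cdS i U μ (cdsS i U ν (cdS i U ν w))) (cdS i U μ w)
        ≤ ∑ z, ε ((shiftY i ν).symm z) * (∑ a, ∑ b, ‖cdS i U ν w (shiftY i μ ((shiftY i ν).symm z)) a b‖ ^ 2
            + ∑ a, ∑ b, ‖cdS i U μ w z a b‖ ^ 2) := by
    intro μ ν
    rw [trIP_eq_re_trace]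
    refine Finset.sum_le_sum fun z _ => ?_
    rw [one_mul]
    exact (le_abs_self _).trans (abs_re_trace_le_of_hs_le (hε _) (hs_cdsS_cdS_sub_le i hG hU hF μ ν (cdS i U ν w) z))
  -- assemble: `E ≤ ‖Δw‖² + E∕4 + X` ⇒ `E ≤ (4∕3)(‖Δw‖² + X)`
  have hsum := Finset.sum_le_sum fun μ (_ : μ ∈ (Finset.univ : Finset (Fin (d + 1)))) =>
    Finset.sum_le_sum fun ν (_ : ν ∈ (Finset.univ : Finset (Fin (d + 1)))) => add_le_add (hC μ ν) (hC' μ ν)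
  have hE : ∑ μ : Fin (d + 1), ∑ ν : Fin (d + 1),
      (trIP (fun _ => (1 : ℝ)) (cdS i U μ (cdS i U ν w)) (cdS i U μ (cdS i U ν w)) / 4
          + 4 * ∑ z, ε z ^ 2 * ∑ a, ∑ b, ‖w (shiftY i ν (shiftY i μ z)) a b‖ ^ 2
        + ∑ z, ε ((shiftY i ν).symm z) * (∑ a, ∑ b, ‖cdS i U ν w (shiftY i μ ((shiftY i ν).symm z)) a b‖ ^ 2
            + ∑ a, ∑ b, ‖cdS i U μ w z a b‖ ^ 2))
      = (∑ μ : Fin (d + 1), ∑ ν : Fin (d + 1), trIP (fun _ => (1 : ℝ)) (cdS i U μ (cdS i U ν w)) (cdS i U μ (cdS i U ν w))) / 4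
        + ∑ μ : Fin (d + 1), ∑ ν : Fin (d + 1),
            (4 * ∑ z, ε z ^ 2 * ∑ a, ∑ b, ‖w (shiftY i ν (shiftY i μ z)) a b‖ ^ 2
              + ∑ z, ε ((shiftY i ν).symm z) * (∑ a, ∑ b, ‖cdS i U ν w (shiftY i μ ((shiftY i ν).symm z)) a b‖ ^ 2
                  + ∑ a, ∑ b, ‖cdS i U μ w z a b‖ ^ 2)) := by
    rw [Finset.sum_div, ← Finset.sum_add_distrib]
    refine Finset.sum_congr rfl fun μ _ => ?_
    rw [Finset.sum_div, ← Finset.sum_add_distrib]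
    refine Finset.sum_congr rfl fun ν _ => ?_
    ring
  rw [hE] at hsum
  linarith

end Bochner

section Uniform

/-! ## §2 A uniform window -/

/-- ★★ **THE BOCHNER–WEITZENBÖCK INEQUALITY UNDER A UNIFORM PLAQUETTE WINDOW** `|U(∂p) − 1| ≤ ε₀` (all plaquettes):
`Σ_{μν}‖∇_μ∇_νw‖² ≤ (4∕3)·(‖Δ_Uw‖² + 4(d+1)²ε₀²‖w‖² + 2(d+1)ε₀·Σ_μ‖∇_μw‖²)`.
[cite: Balaban1985BackgroundPropagators, (3.8) p.392, (3.23) p.395, (3.35) p.396, (3.117)–(3.120) p.419] -/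
theorem bochner_le_uniform (hG : G ≤ B7Prop2Explicit.unitaryUnits (Matrix (Fin N) (Fin N) ℂ)) {U : CfgY (Matrix (Fin N) (Fin N) ℂ) i}
    (hU : ∀ μ x, U μ x ∈ G) {ε₀ : ℝ}
    (hF : ∀ μ ν z, ‖((plaqU (shiftY i) (UboxY i U) μ ν z : (Matrix (Fin N) (Fin N) ℂ)ˣ) : Matrix (Fin N) (Fin N) ℂ) - 1‖ ≤ ε₀)
    (w : SiteY i → Matrix (Fin N) (Fin N) ℂ) :
    ∑ μ : Fin (d + 1), ∑ ν : Fin (d + 1), trIP (fun _ => (1 : ℝ)) (cdS i U μ (cdS i U ν w)) (cdS i U μ (cdS i U ν w))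
      ≤ 4 / 3 * (trIP (fun _ => (1 : ℝ)) (lapS i U w) (lapS i U w) + 4 * ((d : ℝ) + 1) ^ 2 * ε₀ ^ 2 * trIP (fun _ => (1 : ℝ)) w w
          + 2 * ((d : ℝ) + 1) * ε₀ * ∑ μ : Fin (d + 1), trIP (fun _ => (1 : ℝ)) (cdS i U μ w) (cdS i U μ w)) := by
  -- reindex the shifted sums, then count the `(d+1)²` ∕ `2(d+1)` copies
  have r1 : ∀ μ ν : Fin (d + 1), (∑ z, ε₀ ^ 2 * ∑ a, ∑ b, ‖w (shiftY i ν (shiftY i μ z)) a b‖ ^ 2) = ε₀ ^ 2 * trIP (fun _ => (1 : ℝ)) w w := by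
    intro μ ν
    rw [← Finset.mul_sum, trIP_one_self_eq,
      Fintype.sum_equiv ((shiftY i μ).trans (shiftY i ν)) (fun z => ∑ a, ∑ b, ‖w (shiftY i ν (shiftY i μ z)) a b‖ ^ 2)
        (fun z => ∑ a, ∑ b, ‖w z a b‖ ^ 2) fun z => rfl]
  have r2 : ∀ μ ν : Fin (d + 1), (∑ z, ε₀ * (∑ a, ∑ b, ‖cdS i U ν w (shiftY i μ ((shiftY i ν).symm z)) a b‖ ^ 2 + ∑ a, ∑ b, ‖cdS i U μ w z a b‖ ^ 2))
      = ε₀ * trIP (fun _ => (1 : ℝ)) (cdS i U ν w) (cdS i U ν w) + ε₀ * trIP (fun _ => (1 : ℝ)) (cdS i U μ w) (cdS i U μ w) := by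
    intro μ ν
    rw [← Finset.mul_sum, Finset.sum_add_distrib, trIP_one_self_eq, trIP_one_self_eq, ← mul_add,
      Fintype.sum_equiv (((shiftY i ν).symm).trans (shiftY i μ)) (fun z => ∑ a, ∑ b, ‖cdS i U ν w (shiftY i μ ((shiftY i ν).symm z)) a b‖ ^ 2)
        (fun z => ∑ a, ∑ b, ‖cdS i U ν w z a b‖ ^ 2) fun z => rfl]
  have hs : ∑ μ : Fin (d + 1), ∑ ν : Fin (d + 1), (4 * ∑ z, ε₀ ^ 2 * ∑ a, ∑ b, ‖w (shiftY i ν (shiftY i μ z)) a b‖ ^ 2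
          + ∑ z, ε₀ * (∑ a, ∑ b, ‖cdS i U ν w (shiftY i μ ((shiftY i ν).symm z)) a b‖ ^ 2 + ∑ a, ∑ b, ‖cdS i U μ w z a b‖ ^ 2))
      = 4 * ((d : ℝ) + 1) ^ 2 * ε₀ ^ 2 * trIP (fun _ => (1 : ℝ)) w w
        + 2 * ((d : ℝ) + 1) * ε₀ * ∑ μ : Fin (d + 1), trIP (fun _ => (1 : ℝ)) (cdS i U μ w) (cdS i U μ w) := by
    rw [Finset.sum_congr rfl fun μ _ => Finset.sum_congr rfl fun ν _ => by rw [r1, r2]]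
    simp only [Finset.sum_add_distrib, Finset.sum_const, Finset.card_univ, Fintype.card_fin, nsmul_eq_mul, ← Finset.mul_sum]
    push_cast
    ring
  have h : ∑ μ : Fin (d + 1), ∑ ν : Fin (d + 1), trIP (fun _ => (1 : ℝ)) (cdS i U μ (cdS i U ν w)) (cdS i U μ (cdS i U ν w))
      ≤ 4 / 3 * (trIP (fun _ => (1 : ℝ)) (lapS i U w) (lapS i U w)
          + ∑ μ : Fin (d + 1), ∑ ν : Fin (d + 1),
              (4 * ∑ z, ε₀ ^ 2 * ∑ a, ∑ b, ‖w (shiftY i ν (shiftY i μ z)) a b‖ ^ 2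
                + ∑ z, ε₀ * (∑ a, ∑ b, ‖cdS i U ν w (shiftY i μ ((shiftY i ν).symm z)) a b‖ ^ 2
                    + ∑ a, ∑ b, ‖cdS i U μ w z a b‖ ^ 2))) :=
    bochner_le i hG hU (ε := fun _ => ε₀) hF w
  rw [hs, ← add_assoc] at h
  exact h

end Uniform

section Duality

/-! ## §3 Duality: an `H²` bound for a symmetric `T` bounds `T∇*∇*` -/

/-- ★★ **DUALITY FOR THE SECOND-ORDER MEMBER `T∇*_ν∇*_μ`** (`T` trace-symmetric, e.g. `M_hG′_□M_h`; unitary-valued `U`): an `H²` bound for `T`,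
`‖∇_μ∇_ν(TΨ)‖² ≤ C²‖Ψ‖²` for all `Ψ`, gives `‖T(∇*_ν∇*_μλ)‖² ≤ C²‖λ‖²` for all `λ` — the shape of (3.46)'s fourth member `G′∇*∇*` (dag-n06-k's `L2SecondLegs37.l5`)
from its sixth `∇∇G′` (twice (3.8)). [cite: Balaban1985BackgroundPropagators, (3.8) p.392, (3.46) p.398, Cor 3.6 p.408] -/
theorem trIP_T_cdsS_cdsS_le_of_hessian {U : CfgY (Matrix (Fin N) (Fin N) ℂ) i} (hU : ∀ μ x, (U μ x : Matrix (Fin N) (Fin N) ℂ) ∈ unitary (Matrix (Fin N) (Fin N) ℂ))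
    {T : (SiteY i → Matrix (Fin N) (Fin N) ℂ) → (SiteY i → Matrix (Fin N) (Fin N) ℂ)}
    (hT : ∀ Φ Ψ, trIP (fun _ => (1 : ℝ)) (T Φ) Ψ = trIP (fun _ => (1 : ℝ)) Φ (T Ψ)) (μ ν : Fin (d + 1)) {C : ℝ} (hC : 0 ≤ C)
    (hH : ∀ Ψ, trIP (fun _ => (1 : ℝ)) (cdS i U μ (cdS i U ν (T Ψ))) (cdS i U μ (cdS i U ν (T Ψ))) ≤ C ^ 2 * trIP (fun _ => (1 : ℝ)) Ψ Ψ)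
    (Λ : SiteY i → Matrix (Fin N) (Fin N) ℂ) :
    trIP (fun _ => (1 : ℝ)) (T (cdsS i U ν (cdsS i U μ Λ))) (T (cdsS i U ν (cdsS i U μ Λ))) ≤ C ^ 2 * trIP (fun _ => (1 : ℝ)) Λ Λ := by
  have hvv : trIP (fun _ => (1 : ℝ)) (T (cdsS i U ν (cdsS i U μ Λ))) (T (cdsS i U ν (cdsS i U μ Λ)))
      = trIP (fun _ => (1 : ℝ)) (cdS i U μ (cdS i U ν (T (T (cdsS i U ν (cdsS i U μ Λ)))))) Λ := by
    calc trIP (fun _ => (1 : ℝ)) (T (cdsS i U ν (cdsS i U μ Λ))) (T (cdsS i U ν (cdsS i U μ Λ)))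
        = trIP (fun _ => (1 : ℝ)) (cdsS i U ν (cdsS i U μ Λ)) (T (T (cdsS i U ν (cdsS i U μ Λ)))) := hT _ _
      _ = trIP (fun _ => (1 : ℝ)) (T (T (cdsS i U ν (cdsS i U μ Λ)))) (cdsS i U ν (cdsS i U μ Λ)) := trIP_comm _ _ _
      _ = trIP (fun _ => (1 : ℝ)) (cdS i U ν (T (T (cdsS i U ν (cdsS i U μ Λ))))) (cdsS i U μ Λ) := (trIP_cdS_left i hU ν _ _).symm
      _ = _ := (trIP_cdS_left i hU μ _ _).symm
  set v := T (cdsS i U ν (cdsS i U μ Λ)) with hv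
  have hv0 : 0 ≤ trIP (fun _ => (1 : ℝ)) v v := trIP_self_nonneg _ (fun _ => one_pos) v
  have hΛ0 : 0 ≤ trIP (fun _ => (1 : ℝ)) Λ Λ := trIP_self_nonneg _ (fun _ => one_pos) Λ
  have hcs := abs_trIP_le (fun _ => (1 : ℝ)) (fun _ => one_pos) (cdS i U μ (cdS i U ν (T v))) Λ
  have hHv := hH v
  set a := Real.sqrt (trIP (fun _ => (1 : ℝ)) v v) with ha
  set b := Real.sqrt (trIP (fun _ => (1 : ℝ)) Λ Λ) with hb
  have ha0 : 0 ≤ a := Real.sqrt_nonneg _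
  have hb0 : 0 ≤ b := Real.sqrt_nonneg _
  have hH' : Real.sqrt (trIP (fun _ => (1 : ℝ)) (cdS i U μ (cdS i U ν (T v))) (cdS i U μ (cdS i U ν (T v)))) ≤ C * a := by
    rw [ha, ← Real.sqrt_sq hC, ← Real.sqrt_mul (sq_nonneg C)]
    exact Real.sqrt_le_sqrt hHv
  have h1 : trIP (fun _ => (1 : ℝ)) v v ≤ C * a * b :=
    calc trIP (fun _ => (1 : ℝ)) v v = trIP (fun _ => (1 : ℝ)) (cdS i U μ (cdS i U ν (T v))) Λ := hvv
      _ ≤ |trIP (fun _ => (1 : ℝ)) (cdS i U μ (cdS i U ν (T v))) Λ| := le_abs_self _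
      _ ≤ Real.sqrt (trIP (fun _ => (1 : ℝ)) (cdS i U μ (cdS i U ν (T v))) (cdS i U μ (cdS i U ν (T v)))) * b := hcs
      _ ≤ C * a * b := mul_le_mul_of_nonneg_right hH' hb0
  have hsq : a ^ 2 = trIP (fun _ => (1 : ℝ)) v v := by rw [ha]; exact Real.sq_sqrt hv0
  have h2 : a ≤ C * b := by
    have h1' : a ^ 2 ≤ C * a * b := by rw [hsq]; exact h1
    rcases eq_or_lt_of_le ha0 with h0 | hpos
    · rw [← h0]; positivity
    · nlinarith
  calc trIP (fun _ => (1 : ℝ)) v v = a ^ 2 := hsq.symm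
    _ ≤ (C * b) ^ 2 := pow_le_pow_left₀ ha0 h2 2
    _ = C ^ 2 * trIP (fun _ => (1 : ℝ)) Λ Λ := by rw [mul_pow, hb, Real.sq_sqrt hΛ0]

end Duality

section Sums

/-! ## §4 Global sums used by file 28: the level-weighted averaging line, direction counting -/

open Literature.MathematicalPhysics.QuantumFieldTheory.Balaban1983to89.B9Thm37CubeCoverCommutatorSizes (avgCoeffY_nonneg)
open Literature.MathematicalPhysics.QuantumFieldTheory.Balaban1983to89.B9Thm311DeltaPrimeSymm (avgCoeffY_eq_ite avgCoeffY_symm)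
open B6Geom246MultiLevelBox B9Thm31SitePolarisedFormY

/-- the level-weighted averaging sum of a field living on `D` with levels `≥ j′_D`: `Σ_z m_z Σ_w a(z,w)HS(Λ w) ≤ m_D²·Σ_z HS(Λ z)`, `m_z = L^{−2 lev z}`, `m_D = L^{−2j′_D}`.
[cite: Balaban1984PropagatorsII, (2.13)–(2.14) p.225; Balaban1985BackgroundPropagators, (3.24) p.394, bookkeeping] -/
theorem sum_levelMass_avg_le {D : Finset (SiteY i)} {Λ : SiteY i → Matrix (Fin N) (Fin N) ℂ} (hΛ : ∀ z, z ∉ D → Λ z = 0)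
    {jD' : ℕ} (hjD' : ∀ z ∈ D, jD' ≤ (blkOf i.D.toDomains z).1.1) :
    ∑ z, (((((ℓ + 1) ^ (blkOf i.D.toDomains z).1.1 : ℕ) : ℝ)) ^ 2)⁻¹ * ∑ w, avgCoeffY i z w * ∑ a, ∑ b, ‖Λ w a b‖ ^ 2
      ≤ ((((((ℓ + 1) ^ jD' : ℕ) : ℝ)) ^ 2)⁻¹) ^ 2 * ∑ z, ∑ a, ∑ b, ‖Λ z a b‖ ^ 2 := by
  classical
  set m : SiteY i → ℝ := fun z => (((((ℓ + 1) ^ (blkOf i.D.toDomains z).1.1 : ℕ) : ℝ)) ^ 2)⁻¹ with hm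
  set mD : ℝ := (((((ℓ + 1) ^ jD' : ℕ) : ℝ)) ^ 2)⁻¹ with hmD
  have hm0 : ∀ z, 0 ≤ m z := fun z => by positivity
  have hmD0 : 0 ≤ mD := by positivity
  have hmle : ∀ z ∈ D, m z ≤ mD := by
    intro z hz
    apply inv_anti₀ (by positivity)
    have : (((ℓ + 1) ^ jD' : ℕ) : ℝ) ≤ (((ℓ + 1) ^ (blkOf i.D.toDomains z).1.1 : ℕ) : ℝ) := by
      exact_mod_cast Nat.pow_le_pow_right (Nat.succ_pos ℓ) (hjD' z hz)
    exact pow_le_pow_left₀ (by positivity) this 2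
  -- swap the sums; on the support of `a(z,w)` the two sites share their block, so `m_z = m_w`
  set H : SiteY i → ℝ := fun w => ∑ a, ∑ b, ‖Λ w a b‖ ^ 2 with hH
  show ∑ z, m z * ∑ w, avgCoeffY i z w * H w ≤ mD ^ 2 * ∑ z, H z
  have hH0 : ∀ w, 0 ≤ H w := fun w => hs_nonneg _
  have hswap : ∑ z, m z * ∑ w, avgCoeffY i z w * H w = ∑ w, (∑ z, m w * avgCoeffY i z w) * H w := by
    simp_rw [Finset.mul_sum, Finset.sum_mul]
    rw [Finset.sum_comm]
    refine Finset.sum_congr rfl fun w _ => Finset.sum_congr rfl fun z _ => ?_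
    by_cases hb : blkOf i.D.toDomains w = blkOf i.D.toDomains z
    · simp only [hm, hb]; ring
    · rw [avgCoeffY_eq_ite, if_neg hb]; ring
  rw [hswap, Finset.mul_sum]
  refine Finset.sum_le_sum fun w _ => ?_
  by_cases hw : w ∈ D
  · have h1 : ∑ z, m w * avgCoeffY i z w ≤ mD * mD := by
      rw [← Finset.mul_sum]
      have hs : ∑ z, avgCoeffY i z w ≤ m w := by
        calc ∑ z, avgCoeffY i z w = ∑ z, avgCoeffY i w z := Finset.sum_congr rfl fun z _ => avgCoeffY_symm i z w
          _ ≤ m w := sum_avgCoeffY_le i w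
      calc m w * ∑ z, avgCoeffY i z w ≤ m w * m w := mul_le_mul_of_nonneg_left hs (hm0 w)
        _ ≤ mD * mD := mul_le_mul (hmle w hw) (hmle w hw) (hm0 w) hmD0
    calc (∑ z, m w * avgCoeffY i z w) * H w ≤ (mD * mD) * H w := mul_le_mul_of_nonneg_right h1 (hH0 w)
      _ = mD ^ 2 * H w := by ring
  · have : H w = 0 := by simp only [hH, hΛ w hw]; simp
    rw [this, mul_zero, mul_zero]

omit i in
/-- counting: `Σ_μ Σ_ν (A + e(G ν + G μ)) = (d+1)²A + 2(d+1)e·Σ_μ G μ`. [cite: Balaban1985BackgroundPropagators, (3.46) p.398, bookkeeping] -/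
theorem sum_sum_const_add_pair (A e : ℝ) (G : Fin (d + 1) → ℝ) :
    ∑ μ : Fin (d + 1), ∑ ν : Fin (d + 1), (A + e * (G ν + G μ)) = ((d : ℝ) + 1) ^ 2 * A + 2 * ((d : ℝ) + 1) * e * ∑ μ : Fin (d + 1), G μ := by
  simp only [Finset.sum_add_distrib, Finset.sum_const, Finset.card_univ, Fintype.card_fin, nsmul_eq_mul, mul_add, ← Finset.mul_sum]
  push_cast
  ring

end Sums

end Literature.MathematicalPhysics.QuantumFieldTheory.Balaban1983to89.B9Thm31SiteBochnerY
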